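import Literature.Barriers.ABC.BakerMethodBoundsStewartYu1991OfYu1990Proofs
import HarnessLib

/-!
# Proofs for `BakerMethodBounds`, VII-bis: the Stewart–Yu 1991 line with a RESTRICTED `p`-adic binder
# (the `p`-adic input assumed only where `log log A ≤ log B`) — so that engines of Waldschmidt-1980
# shape `(log B + log log A) · log log A` also close the rung `stewartYu1991_upperBound`

`Literature/Barriers/ABC/BakerMethodBoundsStewartYu1991LineRestrictedProofs.lean` — proofs companion
(theorems only: no definition, no named fact), sequel to `BakerMethodBoundsStewartYu1991LineProofs.lean`
(file VII) and `BakerMethodBoundsStewartYu1991OfYu1990Proofs.lean` (the door `stewartYu1991_of_yu1990`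
with the archimedean input discharged by the tree's `waldschmidt1980_hW₂`).

WHY (cell `abc-stewartyu`, route `PadicPrimesYuNinety`, p2-g2's memo-04 §1–§2, 2026-08-26): a twist
engine built on the cell's LANDED Waldschmidt-1980/Cijsouw–Waldschmidt architecture outputs, in `log p`
units, the shape `C(m)·p·∏(Vⱼ/log p)·(W + log(2Vmax))·log(2Vmax)` — in the rational-prime clothing
`(c₅n)ⁿ p² (log B + log log A)·log log A·∏ log max(4,q)` — and NOT Yu 1990's product `log B · log log A`
(a `(log log A)²` appears in the corner `B = 3`, `A → ∞`). File VII's door hard-codes the Yu binder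
`hY`. But the printed Stewart–Yu 1991 argument (§3, (10)–(12)) only ever APPLIES Lemma 1 with
`B = 6 log c` and generators `q ≤ G = rad(abc) ≤ abc ≤ c³`, i.e. in the regime `log log A ≤ log B`, where
`(log B + log log A)·log log A ≤ 2·log B·log log A`. So:

* `log_le_of_padicRoute_restricted`, `log_pow_three_le_of_yu1990Restricted_waldschmidt1980`,
  `stewartYu1991_of_yu1990Restricted_waldschmidt1980` — VERBATIM file VII's (9)–(18) and door, with the
  `p`-adic binder weakened to `hY°` := `hY` under the extra hypothesis `log log max(4, max S) ≤ log B`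
  (one new hypothesis `log log G ≤ log B` in the route lemma, discharged in (18) from `G ≤ c³`,
  `UniqueFactorizationMonoid.radical_dvd_self`);
* `stewartYu1991_of_yu1990Restricted` — the same with Waldschmidt's archimedean input discharged
  (`waldschmidt1980_hW₂`, `w80Cw`), i.e. the RESTRICTED DOOR: `hY° → stewartYu1991_upperBound`;
* `yu1990Restricted_of_w80Shape` — the Waldschmidt-shape binder
  `(c₅n)ⁿ p² (log B + log log A) log log A ∏ log max(4,q)` implies `hY°` with constant `2·|c₅|`
  (`(log B + L)L ≤ 2 log B · L` for `0 ≤ L ≤ log B`, `(c₅n)ⁿ ≤ (|c₅|n)ⁿ`, `2 ≤ 2ⁿ`);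
* `stewartYu1991_of_w80Shape` — THE DOOR FOR PATH Z: the Waldschmidt-shape `p`-adic estimate for
  rational primes at every prime `p` implies `stewartYu1991_upperBound` (rung F-A1.M2, `log c ≪_ε
  rad^{2/3+ε}`);
* `yu1990Restricted_of_yu1990` — sanity: the Yu binder implies the restricted one (so file VII's
  door `stewartYu1991_of_yu1990` is `stewartYu1991_of_yu1990Restricted ∘ yu1990Restricted_of_yu1990`).

Everything from (9) on is the printed line [cite: StewartYu1991, §3 (9)–(18) (pp. 228–230)]; the two
linear-forms inputs are binders/landed theorems exactly as in file VII. WHAT THIS IS NOT: no `p`-adic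
estimate is proved here; this file only widens the door.

## References
* [StewartYu1991] C. L. Stewart, K. Yu, *On the abc conjecture*, Math. Ann. 291 (1991), 225–230 —
  Lemma 1 (p. 226), §3 (9)–(18) (pp. 228–230).
* [Yu1990] K. Yu, *Linear forms in p-adic logarithms II*, Compositio Math. 74 (1990) — Cor. 2.3 (p. 32).
* [Waldschmidt1980] M. Waldschmidt, *A lower bound for linear forms in logarithms*, Acta Arith. 37
  (1980) — Prop. 3.8 (p. 274): the shape `(W + log(2V)) log(2V)` (the cell's landed Theorem A).
-/

noncomputable section

open Finset Real Height
open Literature.NumberTheory.DiophantineGeometry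
open Literature.NumberTheory.DiophantineGeometry.Dioph
open Literature.NumberTheory.DiophantineGeometry.Pasten
open Literature.NumberTheory.Transcendental.Waldschmidt1980

namespace Literature.Barriers.ABC

section ThreeRoutesRestricted

variable (Cw : ℕ → ℝ)

/-- **The `p`-adic route through a member `w`, RESTRICTED binder** (as `log_le_of_padicRoute` of
`BakerMethodBoundsStewartYu1991LineProofs`, but the `p`-adic input `hY` is only assumed for
`log log A ≤ log B`, which holds in the door's regime: extra hypothesis `log log G ≤ log B`). (`w` coprime to `uv`, all inside the triple):
if `ord_p w ≤ ord_p(∏_{q ∣ uv} q^{e_q} − 1)` for every `p ∣ w` (the congruences (10)–(12)), with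
`|e_q| ≤ B`, `B ≥ 3`, then by Lemma 1 of the paper (binder `hY`, see
`log_pow_three_le_of_yu1990_waldschmidt1980`) and the max-ord device (9):
`log w ≤ (C r)^{ω(uv)} · P(w)² · ∏_{q ∣ uv} log max(4, q) · (log B · (log G)²)`, where
`|c₅| ≤ C`, `ω(uv) ≤ r`, `P(w)` is the largest prime factor of `w`, `G ≥ 4` bounds the primes of
`uv` and `rad(w)`. [cite: StewartYu1991, (9)–(14)] -/
theorem log_le_of_padicRoute_restricted (c₅ : ℝ)
    (hY : ∀ (p : ℕ), p.Prime → ∀ (S : Finset ℕ), (∀ q ∈ S, q.Prime) → p ∉ S → S.Nonempty →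
      ∀ (e : ℕ → ℤ) (B : ℝ), 3 ≤ B → (∀ q ∈ S, (|e q| : ℝ) ≤ B) →
      Real.log (Real.log ((max 4 (S.sup id) : ℕ) : ℝ)) ≤ Real.log B →
      ∏ q ∈ S, (q : ℚ) ^ e q ≠ 1 →
      (padicValRat p (∏ q ∈ S, (q : ℚ) ^ e q - 1) : ℝ) <
        (c₅ * S.card) ^ S.card * (p : ℝ) ^ 2 * Real.log B *
          Real.log (Real.log ((max 4 (S.sup id) : ℕ) : ℝ)) *
          ∏ q ∈ S, Real.log ((max 4 q : ℕ) : ℝ))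
    {C : ℝ} {r : ℕ} (hc₅C : |c₅| ≤ C) {G : ℝ} (hG4 : 4 ≤ G) {B : ℝ} (hB3 : 3 ≤ B)
    (hGB : Real.log (Real.log G) ≤ Real.log B)
    {w u v : ℕ} (e : ℕ → ℤ) (hw : w ≠ 0) (hwuv : w.Coprime (u * v))
    (hne : (u * v).primeFactors.Nonempty) (hnr : (u * v).primeFactors.card ≤ r)
    (hqG : ∀ q ∈ (u * v).primeFactors, (q : ℝ) ≤ G)
    (hwG : ∏ p ∈ w.primeFactors, (p : ℝ) ≤ G)
    (heB : ∀ q ∈ (u * v).primeFactors, (|e q| : ℝ) ≤ B)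
    (hne1 : ∏ q ∈ (u * v).primeFactors, (q : ℚ) ^ e q ≠ 1)
    (hval : ∀ p ∈ w.primeFactors, (w.factorization p : ℝ) ≤
      padicValRat p (∏ q ∈ (u * v).primeFactors, (q : ℚ) ^ e q - 1)) :
    Real.log w ≤ (C * r) ^ (u * v).primeFactors.card * (largestPrimeFactor w : ℝ) ^ 2 *
      (∏ q ∈ (u * v).primeFactors, Real.log ((max 4 q : ℕ) : ℝ)) *
      (Real.log B * Real.log G ^ 2) := by
  classical
  set T := (u * v).primeFactors with hT
  set n := T.card with hn
  set PL := ∏ q ∈ T, Real.log ((max 4 q : ℕ) : ℝ) with hPL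
  set Pw : ℝ := (largestPrimeFactor w : ℝ) with hPw
  set LG := Real.log G with hLG
  have hC0 : 0 ≤ C := (abs_nonneg c₅).trans hc₅C
  have hG1 : (1 : ℝ) ≤ G := by linarith
  have hLG1 : 1 ≤ LG := by
    rw [hLG, ← Real.log_exp 1]
    apply Real.log_le_log (Real.exp_pos 1)
    have := Real.exp_one_lt_d9; linarith
  have hLG0 : 0 ≤ LG := by linarith
  have hlogB : 0 ≤ Real.log B := Real.log_nonneg (by linarith)
  have hPL1 : 1 ≤ PL := one_le_prod_log_max_four T
  have hTprime : ∀ q ∈ T, q.Prime := fun q hq => Nat.prime_of_mem_primeFactors hq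
  set M : ℝ := (C * r) ^ n * Pw ^ 2 * Real.log B * LG * PL with hM
  have hCr0 : 0 ≤ (C * r) ^ n := pow_nonneg (by positivity) n
  have hM0 : 0 ≤ M := by rw [hM]; positivity
  -- the factor `log log A ≤ log G`
  have hA : Real.log (Real.log ((max 4 (T.sup id) : ℕ) : ℝ)) ≤ LG := by
    have hA4 : (4 : ℝ) ≤ ((max 4 (T.sup id) : ℕ) : ℝ) := by exact_mod_cast le_max_left _ _
    have hAG : ((max 4 (T.sup id) : ℕ) : ℝ) ≤ G := by
      have : ((max 4 (T.sup id) : ℕ) : ℝ) = max (4 : ℝ) ((T.sup id : ℕ) : ℝ) := by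
        push_cast; rfl
      rw [this]
      refine max_le hG4 ?_
      obtain ⟨q, hq, hsup⟩ := Finset.exists_mem_eq_sup T hne id
      rw [hsup]; exact hqG q hq
    have hlogA : 0 < Real.log ((max 4 (T.sup id) : ℕ) : ℝ) := Real.log_pos (by linarith)
    calc Real.log (Real.log ((max 4 (T.sup id) : ℕ) : ℝ))
        ≤ Real.log ((max 4 (T.sup id) : ℕ) : ℝ) - 1 := Real.log_le_sub_one_of_pos hlogA
      _ ≤ Real.log G - 1 := by linarith [Real.log_le_log (by linarith) hAG]
      _ ≤ LG := by rw [hLG]; linarith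
  have hlogA0 : 0 ≤ Real.log (Real.log ((max 4 (T.sup id) : ℕ) : ℝ)) := by
    apply Real.log_nonneg
    rw [← Real.log_exp 1]
    apply Real.log_le_log (Real.exp_pos 1)
    have h4 : (4 : ℝ) ≤ ((max 4 (T.sup id) : ℕ) : ℝ) := by exact_mod_cast le_max_left _ _
    have := Real.exp_one_lt_d9; linarith
  -- every exponent of `w` is at most `M`
  have hbound : ∀ p ∈ w.primeFactors, (w.factorization p : ℝ) ≤ M := by
    intro p hp
    have hpp : p.Prime := Nat.prime_of_mem_primeFactors hp
    have hpT : p ∉ T := by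
      intro hpT
      have h1 : p ∣ w := Nat.dvd_of_mem_primeFactors hp
      have h2 : p ∣ u * v := Nat.dvd_of_mem_primeFactors hpT
      have hg : p ∣ Nat.gcd w (u * v) := Nat.dvd_gcd h1 h2
      rw [hwuv.gcd_eq_one, Nat.dvd_one] at hg
      exact hpp.one_lt.ne' hg
    have hAB : Real.log (Real.log ((max 4 (T.sup id) : ℕ) : ℝ)) ≤ Real.log B := by
      have hA4 : (4 : ℝ) ≤ ((max 4 (T.sup id) : ℕ) : ℝ) := by exact_mod_cast le_max_left _ _
      have hAG : ((max 4 (T.sup id) : ℕ) : ℝ) ≤ G := by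
        have : ((max 4 (T.sup id) : ℕ) : ℝ) = max (4 : ℝ) ((T.sup id : ℕ) : ℝ) := by
          push_cast; rfl
        rw [this]
        refine max_le hG4 ?_
        obtain ⟨q, hq, hsup⟩ := Finset.exists_mem_eq_sup T hne id
        rw [hsup]; exact hqG q hq
      have hlogA : 0 < Real.log ((max 4 (T.sup id) : ℕ) : ℝ) := Real.log_pos (by linarith)
      calc Real.log (Real.log ((max 4 (T.sup id) : ℕ) : ℝ))
          ≤ Real.log (Real.log G) :=
            Real.log_le_log hlogA (Real.log_le_log (by linarith) hAG)
        _ ≤ Real.log B := hGB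
    have key := hY p hpp T hTprime hpT hne e B hB3 heB hAB hne1
    have hpP : (p : ℝ) ^ 2 ≤ Pw ^ 2 := by
      have : (p : ℝ) ≤ Pw := by rw [hPw]; exact_mod_cast le_largestPrimeFactor_of_mem_primeFactors hp
      exact pow_le_pow_left₀ (Nat.cast_nonneg _) this 2
    have hZ0 : 0 ≤ (p : ℝ) ^ 2 * Real.log B * Real.log (Real.log ((max 4 (T.sup id) : ℕ) : ℝ)) * PL := by
      positivity
    have step1 : (c₅ * n) ^ n * (p : ℝ) ^ 2 * Real.log B *
          Real.log (Real.log ((max 4 (T.sup id) : ℕ) : ℝ)) * PL ≤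
        (C * r) ^ n * ((p : ℝ) ^ 2 * Real.log B *
          Real.log (Real.log ((max 4 (T.sup id) : ℕ) : ℝ)) * PL) := by
      rw [show (c₅ * n) ^ n * (p : ℝ) ^ 2 * Real.log B *
          Real.log (Real.log ((max 4 (T.sup id) : ℕ) : ℝ)) * PL =
          (c₅ * n) ^ n * ((p : ℝ) ^ 2 * Real.log B *
          Real.log (Real.log ((max 4 (T.sup id) : ℕ) : ℝ)) * PL) by ring]
      exact mul_le_mul_of_nonneg_right (mul_pow_le_mul_pow_of_abs_le hc₅C hnr) hZ0
    have step2 : (p : ℝ) ^ 2 * Real.log B * Real.log (Real.log ((max 4 (T.sup id) : ℕ) : ℝ)) * PL ≤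
        Pw ^ 2 * Real.log B * LG * PL := by
      apply mul_le_mul_of_nonneg_right _ (by linarith)
      exact mul_le_mul (mul_le_mul_of_nonneg_right hpP hlogB) hA hlogA0 (by positivity)
    calc (w.factorization p : ℝ)
        ≤ padicValRat p (∏ q ∈ T, (q : ℚ) ^ e q - 1) := hval p hp
      _ ≤ (c₅ * n) ^ n * (p : ℝ) ^ 2 * Real.log B *
          Real.log (Real.log ((max 4 (T.sup id) : ℕ) : ℝ)) * PL := key.le
      _ ≤ (C * r) ^ n * (Pw ^ 2 * Real.log B * LG * PL) :=
          step1.trans (mul_le_mul_of_nonneg_left step2 hCr0)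
      _ = M := by rw [hM]; ring
  -- (9)
  have h9 := log_le_mul_log_prod_primeFactors hw hbound
  have hradw : Real.log (∏ p ∈ w.primeFactors, (p : ℝ)) ≤ LG := by
    rw [hLG]
    apply Real.log_le_log _ hwG
    exact Finset.prod_pos fun q hq => by exact_mod_cast (Nat.prime_of_mem_primeFactors hq).pos
  calc Real.log w ≤ M * Real.log (∏ p ∈ w.primeFactors, (p : ℝ)) := h9
    _ ≤ M * LG := mul_le_mul_of_nonneg_left hradw hM0
    _ = (C * r) ^ n * Pw ^ 2 * PL * (Real.log B * LG ^ 2) := by rw [hM]; ring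

end ThreeRoutesRestricted

section MainRestricted

variable (Cw : ℕ → ℝ)

set_option maxHeartbeats 800000 in
/-- **Stewart–Yu 1991, (13)·(14)·(16) ⟹ (17) ⟹ (18), RESTRICTED `p`-adic binder.** For an abc triple `a + b = c` with
`a ≤ b` and `c ≥ 3`, writing `r = ω(abc)`, `G = rad(abc)`, `C = 2 max{1, |c₅|, |c₆|}`:
`(log c)³ ≤ 23040000 · ((600 C)²)^r · G² · (log G)^{12} · (log(6 log c))³`, from
(Y) Lemma 1 of the paper in the form in which it is applied in (10)–(12) — for a prime `p`, a
    non-empty set `S` of primes not containing `p`, integers `e_q` with `|e_q| ≤ B`, `B ≥ 3`, and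
    `Θ = ∏_{q ∈ S} q^{e_q} − 1 ≠ 0`:
    `ord_p Θ < (c₅ #S)^{#S} · p² · log B · log log A · ∏_{q ∈ S} log max(4, q)`,
    `A = max(4, max S)` — i.e. Yu 1990, Corollary 2.3 (`n ≥ 2`) / Lemma 1.4 (`n = 1`) in
    `K = ℚ(ζ₄)` (`p > 2`) resp. `ℚ(ζ₆)` (`p = 2`) for the generators `q ∈ S` (with `2` replaced by
    `1 + i` when `p > 2`), whose Kummer condition is Lemma 3 of the paper; the fourth powers of
    the paper (`u − 1 ∣ u⁴ − 1`, `2⁴ = (1 + i)⁸`) only change `B` by a factor `≤ 8`, absorbed in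
    `c₅` as `log(8B) ≤ 3 log B` for `B ≥ 3`
    [cite: StewartYu1991, Lemma 1, Lemma 3, (10)–(12)] [cite: Yu1990, Corollary 2.3 (p. 32)];
(W) Lemma 2 of the paper = Waldschmidt 1980, Proposition 3.8 over `ℚ` with `q = 2` at `E = 2`
    — verbatim the binder `hW₂` of `BakerMethodBoundsKummerArchProofs` (whose Kummer condition
    for prime generators is again Lemma 3), with a constant function `0 ≤ Cw(n) ≤ (c₆ n)ⁿ`
    [cite: StewartYu1991, Lemma 2] [cite: Waldschmidt1980, Prop 3.8 (p. 274)].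
The routes are the paper's: the max-ord device (9); the congruences (10)–(12) with `B = 6 log c`
(`|e_q| ≤ 3 log c`); `log y ≥ log z / 4`; `x ≥ √y`, or Lemma 2 for `0 < log(z/y) < √2/√z`;
then (17) and Lemma 4 without the three largest primes `p_x, p_y, p_z`.
[cite: StewartYu1991, §3, (13)–(18)] -/
theorem log_pow_three_le_of_yu1990Restricted_waldschmidt1980 (c₅ c₆ : ℝ)
    (hCw : ∀ n, 0 ≤ Cw n) (hCwle : ∀ n, Cw n ≤ (c₆ * n) ^ n)
    (hY : ∀ (p : ℕ), p.Prime → ∀ (S : Finset ℕ), (∀ q ∈ S, q.Prime) → p ∉ S → S.Nonempty →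
      ∀ (e : ℕ → ℤ) (B : ℝ), 3 ≤ B → (∀ q ∈ S, (|e q| : ℝ) ≤ B) →
      Real.log (Real.log ((max 4 (S.sup id) : ℕ) : ℝ)) ≤ Real.log B →
      ∏ q ∈ S, (q : ℚ) ^ e q ≠ 1 →
      (padicValRat p (∏ q ∈ S, (q : ℚ) ^ e q - 1) : ℝ) <
        (c₅ * S.card) ^ S.card * (p : ℝ) ^ 2 * Real.log B *
          Real.log (Real.log ((max 4 (S.sup id) : ℕ) : ℝ)) *
          ∏ q ∈ S, Real.log ((max 4 q : ℕ) : ℝ))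
    (hW₂ : ∀ (n : ℕ) (α : Fin (n + 1) → ℚ) (b : Fin (n + 1) → ℤ) (V : Fin (n + 1) → ℝ) (W : ℝ),
      (∀ j, 0 < α j ∧ α j ≠ 1) →
      Module.finrank ℚ ↥(IntermediateField.adjoin ℚ
          (Set.range fun j => Real.sqrt (α j : ℝ))) = 2 ^ (n + 1) →
      Monotone V → 1 ≤ V 0 →
      (∀ j, max (logHeight₁ (α j)) |Real.log (α j : ℝ)| ≤ V j) →
      0 < W → (∀ j, logHeight₁ (b j : ℚ) ≤ W) →
      ∑ j, (b j : ℝ) * Real.log (α j : ℝ) ≠ 0 →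
      Real.exp (-(Cw (n + 1) * (∏ j, V j) * (W + Real.log (2 * V (Fin.last n))) *
          Real.log (2 * (if n = 0 then 1 else V ⟨n - 1, by omega⟩)) / Real.log 2 ^ (n + 2))) <
        |∑ j, (b j : ℝ) * Real.log (α j : ℝ)|)
    {a b c : ℕ} (h : IsABCTriple a b c) (hab : a ≤ b) (hc3 : 3 ≤ c) :
    Real.log c ^ 3 ≤ 23040000 *
      ((600 * (2 * max (max 1 |c₅|) |c₆|)) ^ 2) ^ (a * b * c).primeFactors.card *
      (rad a b c : ℝ) ^ 2 * Real.log (rad a b c : ℝ) ^ 12 * Real.log (6 * Real.log c) ^ 3 := by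
  classical
  obtain ⟨ha, hb, habc, hcop⟩ := id h
  have hc0 : c ≠ 0 := by omega
  have ha0 : a ≠ 0 := ha.ne'
  have hb0 : b ≠ 0 := hb.ne'
  have hb2 : 2 ≤ b := by
    by_contra hlt
    have hb1 : b = 1 := by omega
    have ha1 : a = 1 := by omega
    omega
  have hneq : a ≠ b := by
    intro heq
    rw [heq] at hcop
    have : b = 1 := by simpa using hcop
    omega
  have hac : a.Coprime c := coprime_left_of_isABCTriple h
  have hbc : b.Coprime c := coprime_right_of_isABCTriple h
  have hac_le : a ≤ c := by omega
  have hbc_le : b ≤ c := by omega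
  -- the sets of primes
  set Sa := a.primeFactors with hSa
  set Sb := b.primeFactors with hSb
  set Sc := c.primeFactors with hSc
  set S := (a * b * c).primeFactors with hS
  set r : ℕ := S.card with hr
  have hSab : (a * b).primeFactors = Sa ∪ Sb := Nat.primeFactors_mul ha0 hb0
  have hSca : (c * a).primeFactors = Sc ∪ Sa := Nat.primeFactors_mul hc0 ha0
  have hScb : (c * b).primeFactors = Sc ∪ Sb := Nat.primeFactors_mul hc0 hb0
  have hSabc : S = Sa ∪ Sb ∪ Sc := by
    rw [hS, Nat.primeFactors_mul (mul_ne_zero ha0 hb0) hc0, hSab]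
  have hdab : Disjoint Sa Sb := hcop.disjoint_primeFactors
  have hdac : Disjoint Sa Sc := hac.disjoint_primeFactors
  have hdbc : Disjoint Sb Sc := hbc.disjoint_primeFactors
  have hSaS : Sa ⊆ S := by rw [hSabc]; exact Finset.subset_union_left.trans Finset.subset_union_left
  have hSbS : Sb ⊆ S := by rw [hSabc]; exact Finset.subset_union_right.trans Finset.subset_union_left
  have hScS : Sc ⊆ S := by rw [hSabc]; exact Finset.subset_union_right
  have hSprime : ∀ q ∈ S, q.Prime := fun q hq => Nat.prime_of_mem_primeFactors hq
  have hrsum : r = Sa.card + Sb.card + Sc.card := by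
    rw [hr, hSabc, Finset.card_union_of_disjoint (Finset.disjoint_union_left.mpr ⟨hdac, hdbc⟩),
      Finset.card_union_of_disjoint hdab]
  have hSbne : Sb.Nonempty := Nat.nonempty_primeFactors.mpr (by omega)
  have hScne : Sc.Nonempty := Nat.nonempty_primeFactors.mpr (by omega)
  have hr1 : 1 ≤ r := by rw [hr]; exact Finset.card_pos.mpr (hScne.mono hScS)
  -- the radical, in `ℕ` and in `ℝ`
  set G : ℝ := (rad a b c : ℝ) with hGdef
  have hradS : rad a b c = ∏ q ∈ S, q := by
    rw [rad_def, Nat.radical_eq_prod_primeFactors]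
  have hradpos : 0 < rad a b c := by rw [rad_def]; exact Nat.radical_pos _
  have hGprod : G = ∏ q ∈ S, (q : ℝ) := by rw [hGdef, hradS]; push_cast; rfl
  have hsubG : ∀ U : Finset ℕ, U ⊆ S → ∏ q ∈ U, (q : ℝ) ≤ G := by
    intro U hU
    have h1 : ∏ q ∈ U, q ∣ ∏ q ∈ S, q := Finset.prod_dvd_prod_of_subset U S _ hU
    have h2 : ∏ q ∈ U, q ≤ rad a b c := by rw [hradS]; exact Nat.le_of_dvd (hradS ▸ hradpos) h1
    have h3 := (Nat.cast_le (α := ℝ)).mpr h2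
    rw [Nat.cast_prod] at h3
    rw [hGdef]; exact h3
  have hqG : ∀ q ∈ S, (q : ℝ) ≤ G := by
    intro q hq
    have := hsubG {q} (Finset.singleton_subset_iff.mpr hq)
    rwa [Finset.prod_singleton] at this
  have hG4 : (4 : ℝ) ≤ G := by
    obtain ⟨qb, hqb⟩ := hSbne
    obtain ⟨qc, hqc⟩ := hScne
    have hqb2 : (2 : ℝ) ≤ qb := by exact_mod_cast (Nat.prime_of_mem_primeFactors hqb).two_le
    have hqc2 : (2 : ℝ) ≤ qc := by exact_mod_cast (Nat.prime_of_mem_primeFactors hqc).two_le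
    have hne : qb ≠ qc := fun heq => Finset.disjoint_left.mp hdbc hqb (heq ▸ hqc)
    have hsub : ({qb, qc} : Finset ℕ) ⊆ S := by
      intro q hq
      rcases Finset.mem_insert.mp hq with rfl | hq
      · exact hSbS hqb
      · rw [Finset.mem_singleton] at hq; rw [hq]; exact hScS hqc
    have := hsubG _ hsub
    rw [Finset.prod_pair hne] at this
    nlinarith
  have hG1 : (1 : ℝ) ≤ G := by linarith
  have hG0 : (0 : ℝ) < G := by linarith
  set LG : ℝ := Real.log G with hLG
  have hLG1 : 1 ≤ LG := by
    rw [hLG, ← Real.log_exp 1]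
    apply Real.log_le_log (Real.exp_pos 1)
    have := Real.exp_one_lt_d9; linarith
  have hLG0 : 0 ≤ LG := by linarith
  have hlog4G : ∀ q ∈ S, Real.log ((max 4 q : ℕ) : ℝ) ≤ LG := by
    intro q hq
    apply Real.log_le_log (by exact_mod_cast lt_of_lt_of_le (by norm_num) (le_max_left 4 q))
    have : ((max 4 q : ℕ) : ℝ) = max (4 : ℝ) (q : ℝ) := by push_cast; rfl
    rw [this]; exact max_le hG4 (hqG q hq)
  have h2LG : Real.log (2 * LG) ≤ LG := by
    -- `2 log G ≤ G`: `log(G/2) ≤ G/2 − 1` and `log 2 ≤ 1`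
    have h1 : Real.log G ≤ G / 2 := by
      have h := Real.log_le_sub_one_of_pos (show (0 : ℝ) < G / 2 by linarith)
      rw [Real.log_div hG0.ne' two_ne_zero] at h
      have := Real.log_two_lt_d9
      linarith
    rw [hLG]
    exact Real.log_le_log (by rw [← hLG]; linarith) (by linarith)
  -- the log-bundle `Y = log(6 log c) · (log G)²`
  set Lc : ℝ := Real.log (6 * Real.log c) with hLc
  have hc3r : (3 : ℝ) ≤ c := by exact_mod_cast hc3
  have hlogc1 : 1 ≤ Real.log c := by
    rw [← Real.log_exp 1]
    apply Real.log_le_log (Real.exp_pos 1)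
    have := Real.exp_one_lt_d9; linarith
  have hB3 : (3 : ℝ) ≤ 6 * Real.log c := by linarith
  -- RESTRICTION: `log log G ≤ log B` for `B = 6 log c`, since `G = rad(abc) ≤ abc ≤ c³`
  have hGB : Real.log (Real.log G) ≤ Real.log (6 * Real.log c) := by
    have habc_pos : 0 < a * b * c := by positivity
    have hGabc : rad a b c ≤ a * b * c := by
      rw [rad_def]
      exact Nat.le_of_dvd habc_pos UniqueFactorizationMonoid.radical_dvd_self
    have hc_pos : (0 : ℝ) < c := by exact_mod_cast (show 0 < c by omega)
    have hGc3 : G ≤ (c : ℝ) ^ 3 := by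
      have h1 : (a * b * c : ℕ) ≤ c * c * c :=
        Nat.mul_le_mul (Nat.mul_le_mul hac_le hbc_le) le_rfl
      calc G = (rad a b c : ℝ) := hGdef
        _ ≤ ((a * b * c : ℕ) : ℝ) := by exact_mod_cast hGabc
        _ ≤ ((c * c * c : ℕ) : ℝ) := by exact_mod_cast h1
        _ = (c : ℝ) ^ 3 := by push_cast; ring
    have hlogG : Real.log G ≤ 3 * Real.log c := by
      have h3 : Real.log ((c : ℝ) ^ 3) = 3 * Real.log c := by
        rw [Real.log_pow]; norm_num
      rw [← h3]; exact Real.log_le_log hG0 hGc3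
    have hlogGpos : 0 < Real.log G := by linarith
    calc Real.log (Real.log G) ≤ Real.log (3 * Real.log c) := Real.log_le_log hlogGpos hlogG
      _ ≤ Real.log (6 * Real.log c) := Real.log_le_log (by positivity) (by linarith)
  have hLc1 : 1 ≤ Lc := by
    rw [hLc, ← Real.log_exp 1]
    apply Real.log_le_log (Real.exp_pos 1)
    have := Real.exp_one_lt_d9; linarith
  set Y : ℝ := Lc * LG ^ 2 with hY'
  have hY0 : 0 ≤ Y := by positivity
  -- the constant
  set C : ℝ := 2 * max (max 1 |c₅|) |c₆| with hC
  have hm1 : 1 ≤ max (max 1 |c₅|) |c₆| := le_max_of_le_left (le_max_left _ _)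
  have hm5 : |c₅| ≤ max (max 1 |c₅|) |c₆| := (le_max_right 1 |c₅|).trans (le_max_left _ _)
  have hm6 : |c₆| ≤ max (max 1 |c₅|) |c₆| := le_max_right _ _
  have hc₅C : |c₅| ≤ C := by rw [hC]; linarith [abs_nonneg c₅]
  have hc₆C : 2 * |c₆| ≤ C := by rw [hC]; linarith
  have hC0 : 0 ≤ C := by rw [hC]; linarith
  have hCr1 : 1 ≤ C * r := by
    have : (1 : ℝ) ≤ r := by exact_mod_cast hr1
    rw [hC]; nlinarith
  -- exponent bounds
  have heab : ∀ q ∈ (a * b).primeFactors, |(((2 * expDiff a b q : ℤ)) : ℝ)| ≤ 6 * Real.log c := by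
    intro q hq
    have hq' := abs_expDiff_le ha0 hb0 hcop hac_le hbc_le q (Nat.prime_of_mem_primeFactors hq)
    push_cast
    rw [abs_mul, Nat.abs_ofNat]
    linarith
  have heca : ∀ q ∈ (c * a).primeFactors, (|expDiff c a q| : ℝ) ≤ 6 * Real.log c := by
    intro q hq
    have := abs_expDiff_le hc0 ha0 hac.symm le_rfl hac_le q (Nat.prime_of_mem_primeFactors hq)
    linarith
  have hecb : ∀ q ∈ (c * b).primeFactors, (|expDiff c b q| : ℝ) ≤ 6 * Real.log c := by
    intro q hq
    have := abs_expDiff_le hc0 hb0 hbc.symm le_rfl hbc_le q (Nat.prime_of_mem_primeFactors hq)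
    linarith
  -- **route through `c`** (13)
  have hRc : Real.log c ≤ (C * r) ^ (Sa.card + Sb.card) * (largestPrimeFactor c : ℝ) ^ 2 *
      ((∏ q ∈ Sa, Real.log ((max 4 q : ℕ) : ℝ)) * ∏ q ∈ Sb, Real.log ((max 4 q : ℕ) : ℝ)) * Y := by
    have key := log_le_of_padicRoute_restricted c₅ hY hc₅C hG4 hB3 hGB (fun q => 2 * expDiff a b q) hc0
      (Nat.Coprime.mul_right hac.symm hbc.symm)
      (by rw [hSab]; exact hSbne.mono Finset.subset_union_right)
      (show (a * b).primeFactors.card ≤ r by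
        rw [hr]; exact Finset.card_le_card (by rw [hSab]; exact Finset.union_subset hSaS hSbS))
      (fun q hq => hqG q ((by rw [hSab]; exact Finset.union_subset hSaS hSbS :
        (a * b).primeFactors ⊆ S) hq))
      (hsubG Sc hScS) heab
      (prod_zpow_two_mul_expDiff_ne_one ha0 hb0 hcop hneq)
      (fun p hp => le_padicValRat_route_c h hneq hp)
    rw [hSab, Finset.card_union_of_disjoint hdab, Finset.prod_union hdab] at key
    rw [hY', hLc, hLG]; exact key
  -- **route through `b`** (14)
  have hlogcb : Real.log c ≤ 4 * Real.log b := by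
    have h2b : (c : ℝ) ≤ 2 * b := by exact_mod_cast (show c ≤ 2 * b by omega)
    have hb2r : (2 : ℝ) ≤ b := by exact_mod_cast hb2
    have hlog2b : Real.log 2 ≤ Real.log b := Real.log_le_log two_pos hb2r
    calc Real.log c ≤ Real.log (2 * b) := Real.log_le_log (by positivity) h2b
      _ = Real.log 2 + Real.log b := Real.log_mul two_ne_zero (by positivity)
      _ ≤ 4 * Real.log b := by linarith [Real.log_nonneg (by linarith : (1:ℝ) ≤ b)]
  have hRb : Real.log c ≤ 4 * ((C * r) ^ (Sc.card + Sa.card) * (largestPrimeFactor b : ℝ) ^ 2 *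
      ((∏ q ∈ Sc, Real.log ((max 4 q : ℕ) : ℝ)) * ∏ q ∈ Sa, Real.log ((max 4 q : ℕ) : ℝ)) * Y) := by
    have key := log_le_of_padicRoute_restricted c₅ hY hc₅C hG4 hB3 hGB (expDiff c a) hb0
      (Nat.Coprime.mul_right hbc hcop.symm)
      (by rw [hSca]; exact hScne.mono Finset.subset_union_left)
      (show (c * a).primeFactors.card ≤ r by
        rw [hr]; exact Finset.card_le_card (by rw [hSca]; exact Finset.union_subset hScS hSaS))
      (fun q hq => hqG q ((by rw [hSca]; exact Finset.union_subset hScS hSaS :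
        (c * a).primeFactors ⊆ S) hq))
      (hsubG Sb hSbS) heca
      (prod_zpow_expDiff_ne_one hc0 ha0 hac.symm (by omega))
      (fun p hp => by exact_mod_cast (padicValRat_route_b h hp).symm.le)
    rw [hSca, Finset.card_union_of_disjoint hdac.symm, Finset.prod_union hdac.symm] at key
    rw [hY', hLc, hLG]
    exact hlogcb.trans (by linarith)
  -- **route through `a`** (16)
  have hRa : Real.log c ≤ 16 * ((C * r) ^ (Sc.card + Sb.card) * (largestPrimeFactor a : ℝ) ^ 2 *
      ((∏ q ∈ Sc, Real.log ((max 4 q : ℕ) : ℝ)) * ∏ q ∈ Sb, Real.log ((max 4 q : ℕ) : ℝ)) * Y) := by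
    have hncard : (c * b).primeFactors.card = Sc.card + Sb.card := by
      rw [hScb, Finset.card_union_of_disjoint hdbc.symm]
    have hPLeq : ∏ q ∈ (c * b).primeFactors, Real.log ((max 4 q : ℕ) : ℝ) =
        (∏ q ∈ Sc, Real.log ((max 4 q : ℕ) : ℝ)) * ∏ q ∈ Sb, Real.log ((max 4 q : ℕ) : ℝ) := by
      rw [hScb, Finset.prod_union hdbc.symm]
    have hncr : (c * b).primeFactors.card ≤ r := by rw [hncard, hrsum]; omega
    have hPa1 : (1 : ℝ) ≤ (largestPrimeFactor a : ℝ) ^ 2 := by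
      have : (1 : ℝ) ≤ largestPrimeFactor a := by exact_mod_cast one_le_largestPrimeFactor a
      nlinarith
    by_cases hcase : b ≤ a ^ 2
    · -- `log a ≥ log b / 2 ≥ log c / 8`
      have hloga : Real.log c ≤ 8 * Real.log a := by
        have h1 : (b : ℝ) ≤ (a : ℝ) ^ 2 := by exact_mod_cast hcase
        have h2 : Real.log b ≤ 2 * Real.log a := by
          have e : Real.log ((a : ℝ) ^ 2) = 2 * Real.log a := by rw [Real.log_pow]; norm_num
          rw [← e]
          exact Real.log_le_log (by exact_mod_cast hb) h1
        linarith
      have key := log_le_of_padicRoute_restricted c₅ hY hc₅C hG4 hB3 hGB (expDiff c b) ha0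
        (Nat.Coprime.mul_right hac hcop) (by rw [hScb]; exact hScne.mono Finset.subset_union_left)
        hncr
        (fun q hq => hqG q ((by rw [hScb]; exact Finset.union_subset hScS hSbS :
          (c * b).primeFactors ⊆ S) hq))
        (hsubG Sa hSaS) hecb
        (prod_zpow_expDiff_ne_one hc0 hb0 hbc.symm (by omega))
        (fun p hp => by exact_mod_cast (padicValRat_route_a h hp).symm.le)
      rw [hncard, hPLeq] at key
      rw [hY', hLc, hLG]
      have h0 : 0 ≤ (C * r) ^ (Sc.card + Sb.card) * (largestPrimeFactor a : ℝ) ^ 2 *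
          ((∏ q ∈ Sc, Real.log ((max 4 q : ℕ) : ℝ)) * ∏ q ∈ Sb, Real.log ((max 4 q : ℕ) : ℝ)) *
          (Real.log (6 * Real.log c) * Real.log G ^ 2) := by
        rw [← hLc, ← hLG]
        have : 0 ≤ (C * r) ^ (Sc.card + Sb.card) := pow_nonneg (by positivity) _
        have := one_le_prod_log_max_four Sc
        have := one_le_prod_log_max_four Sb
        positivity
      linarith
    · push Not at hcase
      have key := log_le_of_archRoute Cw c₆ hCw hCwle hW₂ hc₆C hCr1 hLG1 h2LG h hab hc3 hcase hncr
        (fun q hq => hlog4G q ((by rw [hScb]; exact Finset.union_subset hScS hSbS :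
          (c * b).primeFactors ⊆ S) hq))
      rw [hncard, hPLeq] at key
      rw [hY', hLc, hLG]
      refine key.trans ?_
      rw [← hLc, ← hLG, ← hY']
      have h0 : 0 ≤ (C * r) ^ (Sc.card + Sb.card) *
          ((∏ q ∈ Sc, Real.log ((max 4 q : ℕ) : ℝ)) * ∏ q ∈ Sb, Real.log ((max 4 q : ℕ) : ℝ)) * Y := by
        have : 0 ≤ (C * r) ^ (Sc.card + Sb.card) := pow_nonneg (by positivity) _
        have := one_le_prod_log_max_four Sc
        have := one_le_prod_log_max_four Sb
        positivity
      calc 16 * ((C * r) ^ (Sc.card + Sb.card) *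
            ((∏ q ∈ Sc, Real.log ((max 4 q : ℕ) : ℝ)) * ∏ q ∈ Sb, Real.log ((max 4 q : ℕ) : ℝ)) * Y)
          = 16 * ((C * r) ^ (Sc.card + Sb.card) * 1 *
            ((∏ q ∈ Sc, Real.log ((max 4 q : ℕ) : ℝ)) * ∏ q ∈ Sb, Real.log ((max 4 q : ℕ) : ℝ)) * Y) := by
              ring
        _ ≤ 16 * ((C * r) ^ (Sc.card + Sb.card) * (largestPrimeFactor a : ℝ) ^ 2 *
            ((∏ q ∈ Sc, Real.log ((max 4 q : ℕ) : ℝ)) * ∏ q ∈ Sb, Real.log ((max 4 q : ℕ) : ℝ)) * Y) := by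
              apply mul_le_mul_of_nonneg_left _ (by norm_num)
              apply mul_le_mul_of_nonneg_right _ hY0
              apply mul_le_mul_of_nonneg_right _ (by
                have := one_le_prod_log_max_four Sc
                have := one_le_prod_log_max_four Sb
                positivity)
              exact mul_le_mul_of_nonneg_left hPa1 (pow_nonneg (by positivity) _)
  -- **(17): the product of the three routes**
  have h17 := pow_three_le_of_routes (Real.log_nonneg (by linarith)) (by positivity)
    (zero_le_one.trans (one_le_prod_log_max_four Sa)) (zero_le_one.trans (one_le_prod_log_max_four Sb))
    (zero_le_one.trans (one_le_prod_log_max_four Sc)) hY0 hRc hRb hRa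
  -- the top primes `T = {p_a, p_b, p_c} ∩ S`
  set T : Finset ℕ := Sa.filter (fun q => q = largestPrimeFactor a) ∪
    Sb.filter (fun q => q = largestPrimeFactor b) ∪ Sc.filter (fun q => q = largestPrimeFactor c)
    with hT
  have hTa : Sa.filter (fun q => q = largestPrimeFactor a) ⊆ Sa := Finset.filter_subset _ _
  have hTb : Sb.filter (fun q => q = largestPrimeFactor b) ⊆ Sb := Finset.filter_subset _ _
  have hTc : Sc.filter (fun q => q = largestPrimeFactor c) ⊆ Sc := Finset.filter_subset _ _
  have hdTab : Disjoint (Sa.filter (fun q => q = largestPrimeFactor a))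
      (Sb.filter (fun q => q = largestPrimeFactor b)) := hdab.mono hTa hTb
  have hdTabc : Disjoint (Sa.filter (fun q => q = largestPrimeFactor a) ∪
      Sb.filter (fun q => q = largestPrimeFactor b)) (Sc.filter (fun q => q = largestPrimeFactor c)) :=
    Finset.disjoint_union_left.mpr ⟨hdac.mono hTa hTc, hdbc.mono hTb hTc⟩
  have hTS : T ⊆ S := by
    rw [hT]
    exact Finset.union_subset (Finset.union_subset (hTa.trans hSaS) (hTb.trans hSbS)) (hTc.trans hScS)
  have hT3 : T.card ≤ 3 := by
    rw [hT]
    calc _ ≤ (Sa.filter (fun q => q = largestPrimeFactor a) ∪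
          Sb.filter (fun q => q = largestPrimeFactor b)).card +
          (Sc.filter (fun q => q = largestPrimeFactor c)).card := Finset.card_union_le _ _
      _ ≤ (Sa.filter (fun q => q = largestPrimeFactor a)).card +
          (Sb.filter (fun q => q = largestPrimeFactor b)).card +
          (Sc.filter (fun q => q = largestPrimeFactor c)).card := by
            gcongr; exact Finset.card_union_le _ _
      _ ≤ 1 + 1 + 1 := by
            gcongr
            · exact card_filter_eq_largestPrimeFactor_le a
            · exact card_filter_eq_largestPrimeFactor_le b
            · exact card_filter_eq_largestPrimeFactor_le c
  have hTprod : ∏ q ∈ T, (q : ℝ) =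
      (largestPrimeFactor a : ℝ) * largestPrimeFactor b * largestPrimeFactor c := by
    rw [hT, Finset.prod_union hdTabc, Finset.prod_union hdTab, prod_filter_eq_largestPrimeFactor,
      prod_filter_eq_largestPrimeFactor, prod_filter_eq_largestPrimeFactor]
  -- Lemma 4 without the top primes
  have hPLS : ∏ q ∈ S, Real.log ((max 4 q : ℕ) : ℝ) = (∏ q ∈ Sa, Real.log ((max 4 q : ℕ) : ℝ)) *
      (∏ q ∈ Sb, Real.log ((max 4 q : ℕ) : ℝ)) * ∏ q ∈ Sc, Real.log ((max 4 q : ℕ) : ℝ) := by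
    rw [hSabc, Finset.prod_union (Finset.disjoint_union_left.mpr ⟨hdac, hdbc⟩), Finset.prod_union hdab]
  have h18 := pow_card_mul_prod_top_mul_prod_log_le hSprime hTS hT3 hLG1 hlog4G
  rw [hTprod, hPLS, ← hGprod, ← hr] at h18
  -- assemble
  set X : ℝ := (r : ℝ) ^ r * ((largestPrimeFactor a : ℝ) * largestPrimeFactor b * largestPrimeFactor c) *
    ((∏ q ∈ Sa, Real.log ((max 4 q : ℕ) : ℝ)) * (∏ q ∈ Sb, Real.log ((max 4 q : ℕ) : ℝ)) *
      ∏ q ∈ Sc, Real.log ((max 4 q : ℕ) : ℝ)) with hX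
  have hX0 : 0 ≤ X := by
    have := one_le_prod_log_max_four Sa
    have := one_le_prod_log_max_four Sb
    have := one_le_prod_log_max_four Sc
    positivity
  have hXle : X ≤ 600 ^ (r + 1) * G * LG ^ 3 := h18
  have hmain : Real.log c ^ 3 ≤ 64 * Y ^ 3 * ((C ^ r) ^ 2 * X ^ 2) := by
    have e1 : (C * (r : ℝ)) ^ (Sa.card + Sb.card + Sc.card) = C ^ r * (r : ℝ) ^ r := by
      rw [← hrsum, mul_pow]
    have h17' := h17
    rw [e1] at h17'
    calc Real.log c ^ 3 ≤ _ := h17'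
      _ = 64 * Y ^ 3 * ((C ^ r) ^ 2 * X ^ 2) := by rw [hX]; ring
  have hX2 : X ^ 2 ≤ (600 ^ (r + 1) * G * LG ^ 3) ^ 2 := pow_le_pow_left₀ hX0 hXle 2
  have hCr2 : 0 ≤ (C ^ r) ^ 2 := by positivity
  have e3 : ((600 * C) ^ 2) ^ r = ((600 : ℝ) ^ r) ^ 2 * (C ^ r) ^ 2 := by
    rw [← mul_pow, ← mul_pow, ← pow_mul, ← pow_mul, mul_comm 2 r]
  calc Real.log c ^ 3 ≤ 64 * Y ^ 3 * ((C ^ r) ^ 2 * X ^ 2) := hmain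
    _ ≤ 64 * Y ^ 3 * ((C ^ r) ^ 2 * (600 ^ (r + 1) * G * LG ^ 3) ^ 2) := by
        apply mul_le_mul_of_nonneg_left (mul_le_mul_of_nonneg_left hX2 hCr2) (by positivity)
    _ = 23040000 * ((600 * C) ^ 2) ^ r * G ^ 2 * LG ^ 12 * Lc ^ 3 := by
        rw [hY', e3]; ring

end MainRestricted

section TheoremRestricted

variable (Cw : ℕ → ℝ)

/-- **Stewart–Yu 1991 from its two cited inputs, along the printed proof.** The named fact
`stewartYu1991_upperBound` (for every `ε > 0`: `log c ≤ κ(ε) · R^{2/3+ε}` for all abc triples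
with `c ≥ c₀(ε)`, `R = rad(abc)`; the paper's corollary "in particular, for each `ε > 0` …
`z < exp(c₄(ε) G^{2/3+ε})`" of its Theorem `log z < G^{2/3 + c/log log G}`
[cite: StewartYu1991, Theorem (p. 226)]) follows from
(Y) Lemma 1 of the paper (Yu 1990, Corollary 2.3 / Lemma 1.4, with the Kummer condition of
    Lemma 3) in the form applied in (10)–(12), the binder `hY` — an `nⁿ`-quality bound with `p²`
    and the product of the `log` of the generators [cite: StewartYu1991, Lemma 1]
    [cite: Yu1990, Corollary 2.3 (p. 32)], and
(W) Lemma 2 of the paper = Waldschmidt 1980, Proposition 3.8 for `K = ℚ`, `q = 2`, `E = 2`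
    (binder `hW₂`, verbatim that of `BakerMethodBoundsKummerArchProofs`) with any constant
    `0 ≤ Cw(n) ≤ (c₆ n)ⁿ` (Waldschmidt: `C₁(n, 2) ≤ 2^{9n+27} n^{n+4}`, see
    `stewartYu1991_of_yu1990_waldschmidt1980_explicit`) [cite: StewartYu1991, Lemma 2]
    [cite: Waldschmidt1980, Prop 3.8 (p. 274)].
Proof: `log_pow_three_le_of_yu1990_waldschmidt1980` ((17)–(18) of the paper), then
`D^r ≤ A(ε) G^ε` (Lemma 4 once more, `exists_pow_le_mul_rpow`), `(log G)^{12} ≤ (12/ε)^{12} G^ε`,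
and the resolution of `u³ ≤ K³ G^{2+2ε} log(6u)³` (`le_of_pow_three_le_log`); here `c₀ = 3`.
Compare `stewartYu1991_of_yu` (`BakerMethodBoundsHalfExponentProofs`): the `Kⁿ`-quality
`p`-adic theorem of Yu (2007) alone also suffices; the present inputs are those of 1991.
[cite: StewartYu1991, §3] -/
theorem stewartYu1991_of_yu1990Restricted_waldschmidt1980 (c₅ c₆ : ℝ)
    (hCw : ∀ n, 0 ≤ Cw n) (hCwle : ∀ n, Cw n ≤ (c₆ * n) ^ n)
    (hY : ∀ (p : ℕ), p.Prime → ∀ (S : Finset ℕ), (∀ q ∈ S, q.Prime) → p ∉ S → S.Nonempty →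
      ∀ (e : ℕ → ℤ) (B : ℝ), 3 ≤ B → (∀ q ∈ S, (|e q| : ℝ) ≤ B) →
      Real.log (Real.log ((max 4 (S.sup id) : ℕ) : ℝ)) ≤ Real.log B →
      ∏ q ∈ S, (q : ℚ) ^ e q ≠ 1 →
      (padicValRat p (∏ q ∈ S, (q : ℚ) ^ e q - 1) : ℝ) <
        (c₅ * S.card) ^ S.card * (p : ℝ) ^ 2 * Real.log B *
          Real.log (Real.log ((max 4 (S.sup id) : ℕ) : ℝ)) *
          ∏ q ∈ S, Real.log ((max 4 q : ℕ) : ℝ))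
    (hW₂ : ∀ (n : ℕ) (α : Fin (n + 1) → ℚ) (b : Fin (n + 1) → ℤ) (V : Fin (n + 1) → ℝ) (W : ℝ),
      (∀ j, 0 < α j ∧ α j ≠ 1) →
      Module.finrank ℚ ↥(IntermediateField.adjoin ℚ
          (Set.range fun j => Real.sqrt (α j : ℝ))) = 2 ^ (n + 1) →
      Monotone V → 1 ≤ V 0 →
      (∀ j, max (logHeight₁ (α j)) |Real.log (α j : ℝ)| ≤ V j) →
      0 < W → (∀ j, logHeight₁ (b j : ℚ) ≤ W) →
      ∑ j, (b j : ℝ) * Real.log (α j : ℝ) ≠ 0 →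
      Real.exp (-(Cw (n + 1) * (∏ j, V j) * (W + Real.log (2 * V (Fin.last n))) *
          Real.log (2 * (if n = 0 then 1 else V ⟨n - 1, by omega⟩)) / Real.log 2 ^ (n + 2))) <
        |∑ j, (b j : ℝ) * Real.log (α j : ℝ)|) :
    stewartYu1991_upperBound := by
  intro ε' hε'
  -- the parameters `ε`, `C`, `D`, `A`, `K`, `θ`, `κ`
  set ε : ℝ := min (1 / 2) (3 * ε' / 8) with hεdef
  have hε0 : 0 < ε := lt_min (by norm_num) (by positivity)
  have hε2 : ε ≤ 1 / 2 := min_le_left _ _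
  have hε38 : ε ≤ 3 * ε' / 8 := min_le_right _ _
  set C : ℝ := 2 * max (max 1 |c₅|) |c₆| with hC
  have hm1 : 1 ≤ max (max 1 |c₅|) |c₆| := le_max_of_le_left (le_max_left _ _)
  have hC1 : 1 ≤ C := by rw [hC]; linarith
  set D : ℝ := (600 * C) ^ 2 with hD
  have hD1 : 1 ≤ D := by rw [hD]; exact one_le_pow₀ (by linarith)
  obtain ⟨A, hA1, hA⟩ := exists_pow_le_mul_rpow hD1 (show (1 : ℝ) ≤ 600 by norm_num) hε0
  set K₀ : ℝ := 23040000 * A * (12 / ε) ^ 12 with hK₀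
  have h12ε : 1 ≤ 12 / ε := by rw [le_div_iff₀ hε0]; linarith
  have hK₀1 : 1 ≤ K₀ := by
    rw [hK₀]
    have h1 : (1 : ℝ) ≤ 23040000 * A := by nlinarith
    exact one_le_mul_of_one_le_of_one_le h1 (one_le_pow₀ h12ε)
  set K : ℝ := K₀ ^ (1 / 3 : ℝ) with hK
  have hK1 : 1 ≤ K := Real.one_le_rpow hK₀1 (by norm_num)
  have hK3 : K ^ 3 = K₀ := by
    rw [hK, ← Real.rpow_natCast, ← Real.rpow_mul (by linarith)]; norm_num
  set θ : ℝ := (2 + 2 * ε) / 3 with hθ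
  set κ : ℝ := (6 * K / ε) ^ (1 / (1 - ε)) with hκ
  have hκ0 : 0 ≤ κ := Real.rpow_nonneg (by positivity) _
  have hexp : θ / (1 - ε) ≤ 2 / 3 + ε' := by
    rw [div_le_iff₀ (by linarith), hθ]
    have h1 : ε' * ε ≤ ε' / 2 := by nlinarith
    nlinarith
  refine ⟨κ, 3, ?_⟩
  suffices main : ∀ a b c : ℕ, IsABCTriple a b c → a ≤ b → (3 : ℝ) ≤ c →
      Real.log c ≤ κ * (rad a b c : ℝ) ^ (2 / 3 + ε' : ℝ) by
    intro a b c h hc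
    rcases le_total a b with hab | hba
    · exact main a b c h hab hc
    · have := main b a c h.swap hba hc
      rwa [rad_swap] at this
  intro a b c h hab hc3r
  have hc3 : 3 ≤ c := by exact_mod_cast hc3r
  have hA' := log_pow_three_le_of_yu1990Restricted_waldschmidt1980 Cw c₅ c₆ hCw hCwle hY hW₂ h hab hc3
  rw [← hC, ← hD] at hA'
  set G : ℝ := (rad a b c : ℝ) with hGdef
  set r : ℕ := (a * b * c).primeFactors.card with hr
  have hradpos : 0 < rad a b c := by rw [rad_def]; exact Nat.radical_pos _
  have hG1 : (1 : ℝ) ≤ G := by rw [hGdef]; exact_mod_cast hradpos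
  have hG0 : (0 : ℝ) < G := by linarith
  -- `D^r ≤ A G^ε` (Lemma 4) and `(log G)^{12} ≤ (12/ε)^{12} G^ε`
  have hrr : (r : ℝ) ^ r ≤ 600 ^ (r + 1) * G := by
    have := card_pow_card_le_rad a b c
    rw [← hr] at this
    exact this
  have hDr : D ^ r ≤ A * G ^ ε := hA r G hG1 hrr
  have hLG : Real.log G ^ 12 ≤ (12 / ε) ^ 12 * G ^ ε := by
    have h1 : Real.log G ≤ G ^ (ε / 12) / (ε / 12) := Real.log_le_rpow_div hG0.le (by positivity)
    have h2 : 0 ≤ Real.log G := Real.log_nonneg hG1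
    have e : (G ^ (ε / 12)) ^ (12 : ℕ) = G ^ ε := by
      rw [← Real.rpow_natCast, ← Real.rpow_mul hG0.le]; congr 1; push_cast; ring
    calc Real.log G ^ 12 ≤ (G ^ (ε / 12) / (ε / 12)) ^ 12 := pow_le_pow_left₀ h2 h1 12
      _ = (12 / ε) ^ 12 * G ^ ε := by rw [div_pow, e]; field_simp
  -- `(log c)³ ≤ K³ G^{3θ} log(6 log c)³`
  have hlogc1 : 1 ≤ Real.log c := by
    rw [← Real.log_exp 1]
    apply Real.log_le_log (Real.exp_pos 1)
    have := Real.exp_one_lt_d9; linarith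
  have hLc0 : 0 ≤ Real.log (6 * Real.log c) := Real.log_nonneg (by linarith)
  have hGε : G ^ (3 * θ) = G ^ 2 * G ^ ε * G ^ ε := by
    rw [hθ, show (3 : ℝ) * ((2 + 2 * ε) / 3) = 2 + ε + ε by ring, Real.rpow_add hG0,
      Real.rpow_add hG0, Real.rpow_two]
  have hcube : Real.log c ^ 3 ≤ K ^ 3 * G ^ (3 * θ) * Real.log (6 * Real.log c) ^ 3 := by
    calc Real.log c ^ 3 ≤ 23040000 * D ^ r * G ^ 2 * Real.log G ^ 12 * Real.log (6 * Real.log c) ^ 3 := hA'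
      _ ≤ 23040000 * (A * G ^ ε) * G ^ 2 * ((12 / ε) ^ 12 * G ^ ε) * Real.log (6 * Real.log c) ^ 3 := by
          apply mul_le_mul_of_nonneg_right _ (pow_nonneg hLc0 3)
          apply mul_le_mul _ hLG (pow_nonneg (Real.log_nonneg hG1) 12) (by positivity)
          exact mul_le_mul_of_nonneg_right (mul_le_mul_of_nonneg_left hDr (by norm_num)) (by positivity)
      _ = K ^ 3 * G ^ (3 * θ) * Real.log (6 * Real.log c) ^ 3 := by rw [hK3, hK₀, hGε]; ring
  have hfin := le_of_pow_three_le_log hK1 hε0 hε2 hlogc1 hG1 hcube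
  calc Real.log c ≤ (6 * K / ε) ^ (1 / (1 - ε)) * G ^ (θ / (1 - ε)) := hfin
    _ ≤ κ * G ^ (2 / 3 + ε' : ℝ) := by
        rw [← hκ]
        exact mul_le_mul_of_nonneg_left (Real.rpow_le_rpow_of_exponent_le hG1 hexp) hκ0

/-- **The restricted door with the archimedean input discharged**: the restricted Yu binder `hY°`
alone implies `stewartYu1991_upperBound` (Waldschmidt 1980 Prop. 3.8 over `ℚ` is the tree's
`waldschmidt1980_hW₂` with constant `w80Cw ≤ (2^70 n)^n`, as in `stewartYu1991_of_yu1990`).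
[cite: StewartYu1991, Theorem (p. 226)] -/
theorem stewartYu1991_of_yu1990Restricted (c₅ : ℝ)
    (hY : ∀ (p : ℕ), p.Prime → ∀ (S : Finset ℕ), (∀ q ∈ S, q.Prime) → p ∉ S → S.Nonempty →
      ∀ (e : ℕ → ℤ) (B : ℝ), 3 ≤ B → (∀ q ∈ S, (|e q| : ℝ) ≤ B) →
      Real.log (Real.log ((max 4 (S.sup id) : ℕ) : ℝ)) ≤ Real.log B →
      ∏ q ∈ S, (q : ℚ) ^ e q ≠ 1 →
      (padicValRat p (∏ q ∈ S, (q : ℚ) ^ e q - 1) : ℝ) <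
        (c₅ * S.card) ^ S.card * (p : ℝ) ^ 2 * Real.log B *
          Real.log (Real.log ((max 4 (S.sup id) : ℕ) : ℝ)) *
          ∏ q ∈ S, Real.log ((max 4 q : ℕ) : ℝ)) :
    stewartYu1991_upperBound :=
  stewartYu1991_of_yu1990Restricted_waldschmidt1980 w80Cw c₅ (2 ^ 70) w80Cw_nonneg
    (fun n => w80Cw_le n) hY
    (fun n α b V W h1 h2 h3 h4 h5 h6 h7 h8 => waldschmidt1980_hW₂ n α b V W h1 h2 h3 h4 h5 h6 h7 h8)

/-- Sanity: the Yu binder of file VII implies the restricted binder (drop the extra hypothesis).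
[cite: StewartYu1991, Lemma 1 (p. 226)] -/
theorem yu1990Restricted_of_yu1990 (c₅ : ℝ)
    (hY : ∀ (p : ℕ), p.Prime → ∀ (S : Finset ℕ), (∀ q ∈ S, q.Prime) → p ∉ S → S.Nonempty →
      ∀ (e : ℕ → ℤ) (B : ℝ), 3 ≤ B → (∀ q ∈ S, (|e q| : ℝ) ≤ B) →
      ∏ q ∈ S, (q : ℚ) ^ e q ≠ 1 →
      (padicValRat p (∏ q ∈ S, (q : ℚ) ^ e q - 1) : ℝ) <
        (c₅ * S.card) ^ S.card * (p : ℝ) ^ 2 * Real.log B *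
          Real.log (Real.log ((max 4 (S.sup id) : ℕ) : ℝ)) *
          ∏ q ∈ S, Real.log ((max 4 q : ℕ) : ℝ)) :
    ∀ (p : ℕ), p.Prime → ∀ (S : Finset ℕ), (∀ q ∈ S, q.Prime) → p ∉ S → S.Nonempty →
      ∀ (e : ℕ → ℤ) (B : ℝ), 3 ≤ B → (∀ q ∈ S, (|e q| : ℝ) ≤ B) →
      Real.log (Real.log ((max 4 (S.sup id) : ℕ) : ℝ)) ≤ Real.log B →
      ∏ q ∈ S, (q : ℚ) ^ e q ≠ 1 →
      (padicValRat p (∏ q ∈ S, (q : ℚ) ^ e q - 1) : ℝ) <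
        (c₅ * S.card) ^ S.card * (p : ℝ) ^ 2 * Real.log B *
          Real.log (Real.log ((max 4 (S.sup id) : ℕ) : ℝ)) *
          ∏ q ∈ S, Real.log ((max 4 q : ℕ) : ℝ) :=
  fun p hp S hS hpS hne e B hB heB _ hne1 => hY p hp S hS hpS hne e B hB heB hne1

/-- **Waldschmidt shape ⇒ restricted Yu binder.** A `p`-adic estimate for rational primes of the
shape `(c₅n)ⁿ p² (log B + log log A) log log A ∏ log max(4,q)` (what an engine on the Waldschmidt-1980
architecture gives, cell abc-stewartyu memo-04) implies the restricted Yu binder with constant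
`2|c₅|`: for `0 ≤ log log A ≤ log B`, `(log B + log log A) log log A ≤ 2 log B · log log A`, and
`2 (c₅n)ⁿ ≤ (2|c₅|n)ⁿ` for `n ≥ 1`. [cite: StewartYu1991, Lemma 1 (p. 226)]
[cite: Waldschmidt1980, Prop 3.8 (p. 274)] -/
theorem yu1990Restricted_of_w80Shape (c₅ : ℝ)
    (hW : ∀ (p : ℕ), p.Prime → ∀ (S : Finset ℕ), (∀ q ∈ S, q.Prime) → p ∉ S → S.Nonempty →
      ∀ (e : ℕ → ℤ) (B : ℝ), 3 ≤ B → (∀ q ∈ S, (|e q| : ℝ) ≤ B) →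
      ∏ q ∈ S, (q : ℚ) ^ e q ≠ 1 →
      (padicValRat p (∏ q ∈ S, (q : ℚ) ^ e q - 1) : ℝ) <
        (c₅ * S.card) ^ S.card * (p : ℝ) ^ 2 *
          ((Real.log B + Real.log (Real.log ((max 4 (S.sup id) : ℕ) : ℝ))) *
            Real.log (Real.log ((max 4 (S.sup id) : ℕ) : ℝ))) *
          ∏ q ∈ S, Real.log ((max 4 q : ℕ) : ℝ)) :
    ∀ (p : ℕ), p.Prime → ∀ (S : Finset ℕ), (∀ q ∈ S, q.Prime) → p ∉ S → S.Nonempty →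
      ∀ (e : ℕ → ℤ) (B : ℝ), 3 ≤ B → (∀ q ∈ S, (|e q| : ℝ) ≤ B) →
      Real.log (Real.log ((max 4 (S.sup id) : ℕ) : ℝ)) ≤ Real.log B →
      ∏ q ∈ S, (q : ℚ) ^ e q ≠ 1 →
      (padicValRat p (∏ q ∈ S, (q : ℚ) ^ e q - 1) : ℝ) <
        ((2 * |c₅|) * S.card) ^ S.card * (p : ℝ) ^ 2 * Real.log B *
          Real.log (Real.log ((max 4 (S.sup id) : ℕ) : ℝ)) *
          ∏ q ∈ S, Real.log ((max 4 q : ℕ) : ℝ) := by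
  intro p hp S hS hpS hne e B hB heB hAB hne1
  have key := hW p hp S hS hpS hne e B hB heB hne1
  set n : ℕ := S.card with hn
  set LLA : ℝ := Real.log (Real.log ((max 4 (S.sup id) : ℕ) : ℝ)) with hLLA
  set PL : ℝ := ∏ q ∈ S, Real.log ((max 4 q : ℕ) : ℝ) with hPL
  have hn1 : 1 ≤ n := Finset.card_pos.mpr hne
  have hLLA0 : 0 ≤ LLA := by
    rw [hLLA]
    apply Real.log_nonneg
    rw [← Real.log_exp 1]
    apply Real.log_le_log (Real.exp_pos 1)
    have h4 : (4 : ℝ) ≤ ((max 4 (S.sup id) : ℕ) : ℝ) := by exact_mod_cast le_max_left _ _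
    have := Real.exp_one_lt_d9; linarith
  have hlogB : 0 ≤ Real.log B := Real.log_nonneg (by linarith)
  have hPL0 : 0 ≤ PL := by
    rw [hPL]
    exact Finset.prod_nonneg fun q _ => Real.log_nonneg (by
      have : (4 : ℝ) ≤ ((max 4 q : ℕ) : ℝ) := by exact_mod_cast le_max_left _ _
      linarith)
  have hp0 : (0 : ℝ) ≤ (p : ℝ) ^ 2 := by positivity
  -- `(log B + LLA) LLA ≤ 2 log B LLA`
  have hshape : (Real.log B + LLA) * LLA ≤ 2 * Real.log B * LLA := by nlinarith
  -- `(c₅ n)^n ≤ (|c₅| n)^n` and `2 (|c₅| n)^n ≤ (2|c₅| n)^n`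
  have hcn : (c₅ * n) ^ n ≤ (|c₅| * n) ^ n := by
    calc (c₅ * n) ^ n ≤ |(c₅ * n) ^ n| := le_abs_self _
      _ = (|c₅| * n) ^ n := by rw [abs_pow, abs_mul, Nat.abs_cast]
  have h2n : 2 * (|c₅| * n) ^ n ≤ (2 * |c₅| * n) ^ n := by
    have h2 : (2 : ℝ) ≤ 2 ^ n := by
      calc (2 : ℝ) = 2 ^ 1 := (pow_one _).symm
        _ ≤ 2 ^ n := pow_le_pow_right₀ (by norm_num) hn1
    have heq : (2 * |c₅| * (n : ℝ)) ^ n = 2 ^ n * (|c₅| * n) ^ n := by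
      rw [← mul_pow]; ring
    rw [heq]
    exact mul_le_mul_of_nonneg_right h2 (by positivity)
  have hX0 : 0 ≤ (p : ℝ) ^ 2 * ((Real.log B + LLA) * LLA) * PL :=
    mul_nonneg (mul_nonneg hp0 (mul_nonneg (by linarith) hLLA0)) hPL0
  calc (padicValRat p (∏ q ∈ S, (q : ℚ) ^ e q - 1) : ℝ)
      < (c₅ * n) ^ n * (p : ℝ) ^ 2 * ((Real.log B + LLA) * LLA) * PL := key
    _ = (c₅ * n) ^ n * ((p : ℝ) ^ 2 * ((Real.log B + LLA) * LLA) * PL) := by ring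
    _ ≤ (|c₅| * n) ^ n * ((p : ℝ) ^ 2 * ((Real.log B + LLA) * LLA) * PL) :=
        mul_le_mul_of_nonneg_right hcn hX0
    _ ≤ (|c₅| * n) ^ n * ((p : ℝ) ^ 2 * (2 * Real.log B * LLA) * PL) := by
        apply mul_le_mul_of_nonneg_left _ (by positivity)
        exact mul_le_mul_of_nonneg_right (mul_le_mul_of_nonneg_left hshape hp0) hPL0
    _ = (2 * (|c₅| * n) ^ n) * ((p : ℝ) ^ 2 * Real.log B * LLA * PL) := by ring
    _ ≤ (2 * |c₅| * n) ^ n * ((p : ℝ) ^ 2 * Real.log B * LLA * PL) :=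
        mul_le_mul_of_nonneg_right h2n (by positivity)
    _ = (2 * |c₅| * n) ^ n * (p : ℝ) ^ 2 * Real.log B * LLA * PL := by ring

/-- **THE DOOR FOR THE WALDSCHMIDT-SHAPE ENGINE (cell abc-stewartyu PATH Z).** A `p`-adic estimate for
rational primes at every prime `p` of the shape
`ord_p(∏ q^{e_q} − 1) < (c₅ #S)^{#S} · p² · (log B + log log A) · log log A · ∏ log max(4,q)`
(`A = max(4, max S)`, `|e_q| ≤ B`, `B ≥ 3`) implies `stewartYu1991_upperBound`
(`log c ≤ κ(ε) rad(abc)^{2/3+ε}`). [cite: StewartYu1991, Theorem (p. 226), §3 (9)–(18)]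
[cite: Waldschmidt1980, Prop 3.8 (p. 274)] -/
theorem stewartYu1991_of_w80Shape (c₅ : ℝ)
    (hW : ∀ (p : ℕ), p.Prime → ∀ (S : Finset ℕ), (∀ q ∈ S, q.Prime) → p ∉ S → S.Nonempty →
      ∀ (e : ℕ → ℤ) (B : ℝ), 3 ≤ B → (∀ q ∈ S, (|e q| : ℝ) ≤ B) →
      ∏ q ∈ S, (q : ℚ) ^ e q ≠ 1 →
      (padicValRat p (∏ q ∈ S, (q : ℚ) ^ e q - 1) : ℝ) <
        (c₅ * S.card) ^ S.card * (p : ℝ) ^ 2 *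
          ((Real.log B + Real.log (Real.log ((max 4 (S.sup id) : ℕ) : ℝ))) *
            Real.log (Real.log ((max 4 (S.sup id) : ℕ) : ℝ))) *
          ∏ q ∈ S, Real.log ((max 4 q : ℕ) : ℝ)) :
    stewartYu1991_upperBound :=
  stewartYu1991_of_yu1990Restricted (2 * |c₅|) (yu1990Restricted_of_w80Shape c₅ hW)

end TheoremRestricted

end Literature.Barriers.ABC

end
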